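import Mathlib
import HarnessLib
import HarnessLib.Audit
import Summits.Parity.Statement
import Summits.Parity.BatemanHorn.Theorems.RoughValueTransportRoughValueLawSieveBand
import Summits.Parity.BatemanHorn.Theorems.RoughValueTransportSieveCalibrationMertens
import Summits.Parity.BatemanHorn.Theorems.BalancedSemiprimeLayer.Negative.LowerHalf
import HarnessLib.Audit.Status.Attr

/-!
Route: RoughParitySectors

DORMANT since 2026-08-24T10:53:17Z (reconciler: no traction for 6.7 d (last activity item-evidence-added at 2026-08-17T17:02:24Z); parked, not closed — `ledger route dormant route-Parity-RoughParitySectors --off` to reactivate) — unstaffed, not closed; items shared with open routes are served there. `ledger route dormant <id> --off` reactivates.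

# Route RoughParitySectors — Bombieri's dichotomy on deep-sifted values — Bateman–Horn = parity
balance of rough values (u→∞) × a twist-invariant odd-sector prime share × the proved sieve band

For a Bateman–Horn system f = (f_1,…,f_k) (`IsBatemanHornSystem f`), a depth U and x put R_f(x,U) :=
{1 ≤ n ≤ x : every f_i(n) > 0 and
no prime p < x^{deg f_i/U} divides f_i(n)} — the JOINTLY ROUGH set of route RoughValueTransport,
predicate copied verbatim (staggered
value-depth thresholds z_i = x^{deg f_i/U}) — and inside it the PRIME CELL c₁ := #{n ∈ R : every
Ω(f_i(n)) = 1} (= polyPrimeCount f x up to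
O(x^{deg_max/U})) and the ALL-ODD PARITY SECTOR c_odd := #{n ∈ R : every Ω(f_i(n)) odd}. It suffices
to show X = P ∧ A in the iterated
limit "x → ∞, then U → ∞" (nothing is asked at any finite sieve depth): (P = RoughParityBalance,
rank 2) the all-odd sector has its fair
share, 2^k·c_odd = #R·(1 + o(1)) — for k = 1 exactly Σ_{n∈R} λ(f(n)) = o(#R), the pure parity bit:
rough values of f are NOT
Selberg-extremal at infinite depth; (A = OddSectorShareNonlinear ∧ OddSectorShareLinear, ranks 3–4,
split by degree profile) within the
all-odd sector the primes have the integer share, c₁·(U e^{−γ}/2)^k = c_odd·(1 + o(1)) — a RATIO on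
which every Selberg–Bombieri twist
a_n ↦ a_n·∏_i(1 + θ_i λ(f_i(n))) acts trivially (it multiplies every all-odd cell by the same
∏(1−θ_i)), i.e. the exact parity-immune
complement of P. The COUNT needs no crux: #R·(log x)^k/x = (C(f)/∏deg f_i)·e^{−kγ}·U^k·(1 ± ε) for U
≥ U₀(ε), eventually in x, is
PROVABLE NOW (support RoughCountBand) from two lemmas banked by RoughValueTransport's dead line
increment-anchoring
(`Cruxes.RoughValueLaw.IncrementAnchoring.stub_sieveBand`,
`SieveCalibration.tendsto_log_pow_mul_staggeredProd`). Then
c₁ = (2e^γ/U)^k(1±η)·2^{−k}#R(1±δ) = (C(f)/∏deg f_i)(1±η)(1±δ)(1±ε)·x/(log x)^k and η, δ, ε → 0 give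
`BatemanHornAsymptotic f` for every
system, i.e. `_root_.BatemanHorn` (item Assembly; deciding theorem `closes`). Provenance
(recombination lens): RoughValueTransport (object and
calibration; learning: no mechanism exists for any fixed rung, so none is asked), its dead line
increment-anchoring (the band), card
rough-values-buchstab-parity (the signed rough law; only its vanishing tail ρ′(U)/ω(U) → 0 is used,
so its fixed-depth trap is honoured),
LeeYangFibres on the GHL side (parity sectors of joint rough cells; its single-ghost CellParityLaw
and its zero locus are NOT assumed),
AlmostPrimeZeros (the parity-blind / parity split, here an identity instead of a heuristic label).
Lean: `(∀ (k : ℕ) (f : Fin k → Polynomial ℤ), Literature.NumberTheory.Sieve.IsBatemanHornSystem f →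
∀ δ : ℝ, 0 < δ → ∃ U₀ : ℝ, ∀ U : ℝ, U₀ ≤ U → ∀ᶠ x : ℕ in Filter.atTop, |(2 : ℝ) ^ k *
(((((Finset.Icc 1 x).filter (fun n : ℕ => ∀ i, 0 < (f i).eval (n : ℤ) ∧ ∀ p ∈ Finset.range ⌈(x : ℝ)
^ (((f i).natDegree : ℝ) / U)⌉₊, p.Prime → ¬ ((p : ℤ) ∣ (f i).eval (n : ℤ)))).filter (fun n : ℕ => ∀
i, Odd (ArithmeticFunction.cardFactors (((f i).eval (n : ℤ)).toNat)))).card : ℕ) : ℝ) -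
((((Finset.Icc 1 x).filter (fun n : ℕ => ∀ i, 0 < (f i).eval (n : ℤ) ∧ ∀ p ∈ Finset.range ⌈(x : ℝ) ^
(((f i).natDegree : ℝ) / U)⌉₊, p.Prime → ¬ ((p : ℤ) ∣ (f i).eval (n : ℤ)))).card : ℕ) : ℝ)| ≤ δ *
((((Finset.Icc 1 x).filter (fun n : ℕ => ∀ i, 0 < (f i).eval (n : ℤ) ∧ ∀ p ∈ Finset.range ⌈(x : ℝ) ^
(((f i).natDegree : ℝ) / U)⌉₊, p.Prime → ¬ ((p : ℤ) ∣ (f i).eval (n : ℤ)))).card : ℕ) : ℝ)) ∧ (∀ (k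
: ℕ) (f : Fin k → Polynomial ℤ), Literature.NumberTheory.Sieve.IsBatemanHornSystem f → (∃ i, 2 ≤ (f
i).natDegree) → ∀ η : ℝ, 0 < η → ∃ U₀ : ℝ, ∀ U : ℝ, U₀ ≤ U → ∀ᶠ x : ℕ in Filter.atTop,
|(((((Finset.Icc 1 x).filter (fun n : ℕ => ∀ i, 0 < (f i).eval (n : ℤ) ∧ ∀ p ∈ Finset.range ⌈(x : ℝ)
^ (((f i).natDegree : ℝ) / U)⌉₊, p.Prime → ¬ ((p : ℤ) ∣ (f i).eval (n : ℤ)))).filter (fun n : ℕ => ∀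
i, ArithmeticFunction.cardFactors (((f i).eval (n : ℤ)).toNat) = 1)).card : ℕ) : ℝ) * (U * Real.exp
(-Real.eulerMascheroniConstant) / 2) ^ k - (((((Finset.Icc 1 x).filter (fun n : ℕ => ∀ i, 0 < (f
i).eval (n : ℤ) ∧ ∀ p ∈ Finset.range ⌈(x : ℝ) ^ (((f i).natDegree : ℝ) / U)⌉₊, p.Prime → ¬ ((p : ℤ)
∣ (f i).eval (n : ℤ)))).filter (fun n : ℕ => ∀ i, Odd (ArithmeticFunction.cardFactors (((f i).eval
(n : ℤ)).toNat)))).card : ℕ) : ℝ)| ≤ η * (((((Finset.Icc 1 x).filter (fun n : ℕ => ∀ i, 0 < (f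
i).eval (n : ℤ) ∧ ∀ p ∈ Finset.range ⌈(x : ℝ) ^ (((f i).natDegree : ℝ) / U)⌉₊, p.Prime → ¬ ((p : ℤ)
∣ (f i).eval (n : ℤ)))).filter (fun n : ℕ => ∀ i, Odd (ArithmeticFunction.cardFactors (((f i).eval
(n : ℤ)).toNat)))).card : ℕ) : ℝ)) ∧ (∀ (k : ℕ) (f : Fin k → Polynomial ℤ),
Literature.NumberTheory.Sieve.IsBatemanHornSystem f → (∀ i, (f i).natDegree ≤ 1) → ∀ η : ℝ, 0 < η →
∃ U₀ : ℝ, ∀ U : ℝ, U₀ ≤ U → ∀ᶠ x : ℕ in Filter.atTop, |(((((Finset.Icc 1 x).filter (fun n : ℕ => ∀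
i, 0 < (f i).eval (n : ℤ) ∧ ∀ p ∈ Finset.range ⌈(x : ℝ) ^ (((f i).natDegree : ℝ) / U)⌉₊, p.Prime → ¬
((p : ℤ) ∣ (f i).eval (n : ℤ)))).filter (fun n : ℕ => ∀ i, ArithmeticFunction.cardFactors (((f
i).eval (n : ℤ)).toNat) = 1)).card : ℕ) : ℝ) * (U * Real.exp (-Real.eulerMascheroniConstant) / 2) ^
k - (((((Finset.Icc 1 x).filter (fun n : ℕ => ∀ i, 0 < (f i).eval (n : ℤ) ∧ ∀ p ∈ Finset.range ⌈(x :
ℝ) ^ (((f i).natDegree : ℝ) / U)⌉₊, p.Prime → ¬ ((p : ℤ) ∣ (f i).eval (n : ℤ)))).filter (fun n : ℕ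
=> ∀ i, Odd (ArithmeticFunction.cardFactors (((f i).eval (n : ℤ)).toNat)))).card : ℕ) : ℝ)| ≤ η *
(((((Finset.Icc 1 x).filter (fun n : ℕ => ∀ i, 0 < (f i).eval (n : ℤ) ∧ ∀ p ∈ Finset.range ⌈(x : ℝ)
^ (((f i).natDegree : ℝ) / U)⌉₊, p.Prime → ¬ ((p : ℤ) ∣ (f i).eval (n : ℤ)))).filter (fun n : ℕ => ∀
i, Odd (ArithmeticFunction.cardFactors (((f i).eval (n : ℤ)).toNat)))).card : ℕ) : ℝ))`

## Assembly
Real-analysis squeeze plus proved tree facts, system by system, now MACHINE-CHECKED as the route's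
deciding theorem
`closes (hP : RoughParityBalance) (hN : OddSectorShareNonlinear) (hL : OddSectorShareLinear) :
_root_.BatemanHorn` (route-repair g2,
2026-08-16: one self-contained tactic proof rendered in this file, ≈10.7k chars, lean check rc 0,
audit closed = true, axioms
propext/Classical.choice/Quot.sound; no support/assembly item is a hypothesis). Fix f (any k, k = 0
included) and m := C(f)/∏ deg f_i > 0
(`IsBatemanHornSystem.hasBatemanHornConst_holds`). For 0 < τ ≤ 1/8 take U ≥ the three U₀(τ) —
RoughParityBalance; the share crux picked by
the degree profile (`∃ i, deg f_i ≥ 2` → hN, else hL); the PROVED band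
`Cruxes.RoughValueLaw.IncrementAnchoring.stub_sieveBand` with ε = τ —
and U ≥ 4·max deg f_i + 1; staggered Mertens
`Theorems.SieveCalibration.tendsto_log_pow_mul_staggeredProd` gives (log x)^k·V_f(x,U) → B :=
m·e^{−kγ}·U^k. Eventually in x the four relative bands |(log x)^k V − B| ≤ τB, |#R − xV| ≤ τxV, |2^k
c_odd − #R| ≤ τ#R, |c₁A − c_odd| ≤ τc_odd
(A = (Ue^{−γ}/2)^k) chain ADDITIVELY (`step`: each link costs 2τ while the accumulated relative
error stays ≤ 1) to
(1 − 8τ)·xm·(2^kA) ≤ (log x)^k·2^k·c₁A ≤ (1 + 8τ)·xm·(2^kA), via x·B = xm·(2^kA) (2^kA =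
e^{−kγ}U^k); cancelling 2^kA > 0 gives
|c₁(log x)^k − xm| ≤ 8τ·xm. Bookkeeping c₁ ↔ polyPrimeCount: Ω(m) = 1 iff m is prime, so the prime
cell lies in the polyPrimeCount set;
conversely an n counted by polyPrimeCount lies in the prime cell unless n < 1 + max_i M_i or n <
2⌈x^{1/4}⌉₊ — otherwise a prime
p < ⌈x^{deg f_i/U}⌉₊ ≤ ⌈x^{1/4}⌉₊ dividing the prime f_i(n) equals it and n ≤ n^{deg f_i} ≤ 2f_i(n)
= 2p < 2⌈x^{1/4}⌉₊ ≤ n (growth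
`BalancedSemiprimeLayer.Negative.exists_pow_le_two_mul_eval` for n ≥ M_i), a contradiction; so
polyPrimeCount ≤ c₁ + 1 + max M_i + 2⌈x^{1/4}⌉₊
with (1 + max M_i + 2⌈x^{1/4}⌉₊)(log x)^k ≤ τx eventually (`SieveBand.eventually_absorb`). Hence
|polyPrimeCount·(log x)^k/x − m| ≤ τ(8m + 1)
eventually for every τ ≤ 1/8 (`key`); with τ = min(1/8, cm/(8m + 1)) this is the little-o form of
polyPrimeCount f x ~ m·x/(log x)^k, i.e.
`BatemanHornAsymptotic f`, and quantifying over (k, f) gives `_root_.BatemanHorn`. Route-file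
imports added for the proof (all PROVED,
none imports this file): Theorems/RoughValueTransportRoughValueLawSieveBand,
Theorems/RoughValueTransportSieveCalibrationMertens,
Theorems/BalancedSemiprimeLayer/Negative/LowerHalf. The support items RoughCountBand (the calibrated
band) and LinearCalibration (the integer
case of both cruxes) stay as provable-now statements for provers; the old Assembly item
(RoughParityBalance → … → RoughCountBand → BatemanHorn)
is superseded by `closes` and is not load-bearing (the gen-1 landing kit FrameA/B/C on
stmt-Parity-15632 is likewise obsolete).

Rationale: WHY THIS LINE. Mechanism: Bombieri's asymptotic-sieve dichotomy (BombieriAsymptoticSieve1976;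
Selberg1952Limitations; Ford2004; FriedlanderIwaniecOperaDeCribro2010
§3) — a sifted sequence is determined by distributional data up to ONE parity ghost per member — is
used not as a theorem (along a member of
degree ≥ 2 the value-scale level is 1/deg, FordFixedLevelBarrier) but as the COORDINATE SYSTEM in
which Bateman–Horn is cut: (band, a theorem
along f in the fundamental-lemma regime) × (the Walsh–Fourier parity coefficient of the rough
measure, P) × (a ratio every ghost fixes, A).
Imported areas: probabilistic anatomy of sifted integers (Alladi1982 — the Ω-cells of rough
integers, PROVED in the tree with a rate as
`Literature.NumberTheory.Sieve.exists_abs_cell_sub_main_le`, densities `roughCellDensity`;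
Alladi1982Moebius — Möbius over rough integers,
bias ρ′(u)x/log y; Tenenbaum2015 III.6), the fundamental lemma with staggered thresholds
(HalberstamRichert1974, Lichtman2025LinearSieve;
tree: `stub_sieveBand`), Walsh analysis on {±1}^k (as in LeeYangFibres /
Literature.Barriers.Parity.SignGhost). What no parent route or card
has: no statement at any finite depth u (RoughValueTransport needs the shape law at every u > 2 plus
the u↓2 semiprime layer; the card's
RL(f,u) is Bateman–Horn-strength at each rung and "adds no X → BH implication"), no constant, no
zero functional (the landed necessity
theorem `roughLiouvilleSaving_of_roughLatticeCount` shows zero-locus hypotheses on rough polynomials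
ARE parity savings, so none is used), no
LSD law or Vitali; the integer case of BOTH cruxes is a theorem (support LinearCalibration), and the
split is exact: the Selberg twists
a_n ↦ a_n(1 ± λ(f_i(n))) fix the ratio in A identically and change only P (the band, a theorem about
the untwisted count, is not at stake). Negatives index (3 GHL statements) untouched.

RANKED CRUXES. #2 RoughParityBalance (crux) — For every Bateman–Horn system f of k polynomials and
every δ > 0 there is U₀ such that for every U ≥ U₀, for all large x, |2^k·c_odd(x,U) − #R_f(x,U)| ≤
δ·#R_f(x,U): the all-odd parity sector of the jointly rough values has density 2^{−k},
asymptotically in the depth. k = 1: Σ_{n∈R} λ(f(n)) = o_U(#R) ("Alladi along f"); model value of the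
bias at finite U is (ρ′(U)/ω(U))-sized (−0.18 at U = 3, −0.02 at U = 4, −0.002 at U = 5), which is
why no fixed-depth form is asserted (card rough-values-buchstab-parity, signed half, tail only).
[difficulty: open-problem] (why it might fail: It is the parity bit: Selberg's twists 1±λ(fᵢ(n))
keep all root-class data, satisfy the other items and move 2^k·c_odd/#R to 0 or 2; given the share
cruxes and the band it is EQUIVALENT to Bateman–Horn; even f=(X) needs the prime number theorem
(Alladi).) [Alladi1982Moebius, Selberg1952Limitations, BombieriAsymptoticSieve1976, Tenenbaum2015,
Teravainen2024, SawinShusterman2022, Granville1995Irregularities]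
#3 OddSectorShareNonlinear (crux) — For every Bateman–Horn system f with SOME member of degree ≥ 2
and every η > 0 there is U₀ such that for every U ≥ U₀, for all large x, |c₁(x,U)·(U·e^{−γ}/2)^k −
c_odd(x,U)| ≤ η·c_odd(x,U): among jointly rough values with all Ω(f_i(n)) odd, the proportion with
every f_i(n) prime is the integer-model share (2/(U(ω(U)−ρ′(U))))^k → (2e^γ/U)^k. Invariant under
every twist a_n ↦ a_n∏(1+θ_iλ(f_i(n))) (all all-odd cells scale by ∏(1−θ_i)); carries no information
on the prime count beyond the sieve factor 2^k; the dark-anatomy half of Bombieri's dichotomy for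
thin value sets. [difficulty: open-problem] (why it might fail: Dark anatomy past every Type-I
level: prime-vs-E₃,E₅,… frequencies among rough values of a degree≥2 member are not fixed by
root-class data of level x^{1−ε} (value-level 1/deg: Ford-type indeterminacy); an algebraic bias of
the norm values N(n−α) toward split types breaks it.) [Alladi1982, Ford2004,
BombieriAsymptoticSieve1976, IwaniecInventiones1978, Richert1969, Entin2016,
HildebrandTenenbaum1986, FordMaynard2024PrimeSieves]
#4 OddSectorShareLinear (crux) — The same share statement for ALL-LINEAR Bateman–Horn systems (every
deg f_i = 1: Dickson / Hardy–Littlewood tuples, incl. the twin system (X, X+2)): |c₁·(U e^{−γ}/2)^k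
− c_odd| ≤ η·c_odd for U ≥ U₀(η), eventually in x. k = 1 (one progression) is Alladi's cell theorem
in progressions (provable; cf. support LinearCalibration); k ≥ 2 is almost-prime-tuple anatomy in
the Bombieri-rigidity world (each member has bilinear structure and level 1/2; level 1 = GEH), the
interface with GHL routes LeeYangFibres (CellParityLaw ⇒ this item) and RoughSemiprimeRigidity.
[difficulty: XL] (why it might fail: For k≥2 it is almost-prime k-tuple anatomy (e.g. among jointly
rough n, n+2 with odd Ω's, the share with both prime): level-1/2 bilinear data do not fix it
(Ford-type indeterminacy at fixed level), plausibly rigid only under GEH; a tuple-specific bias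
breaks it.) [Alladi1982, BombieriAsymptoticSieve1976, Ford2004, GreenTao2010, HalberstamRichert1974,
Lichtman2025LinearSieve]
#9 RoughCountBand (support) — For every Bateman–Horn system f and ε > 0 there is U₀ such that for
every U ≥ U₀, eventually in x, |#R_f(x,U)·(log x)^k/x − c_f·U^k| ≤ ε·c_f·U^k with c_f = (C(f)/∏deg
f_i)·e^{−kγ}, C(f) = batemanHornConst f. Provable now (size M): combine the banked two-sided
fundamental-lemma band
`Summit.Parity.BatemanHorn.Cruxes.RoughValueLaw.IncrementAnchoring.stub_sieveBand`
(Theorems/RoughValueTransportRoughValueLawSieveBand.lean: |Φ_f(x,U) − xV_f(x,U)| ≤ ε′xV_f(x,U) for U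
≥ U₁(ε′), ∀ᶠ x — same predicate) with staggered Mertens
`SieveCalibration.tendsto_log_pow_mul_staggeredProd`
(Theorems/RoughValueTransportSieveCalibrationMertens.lean: (log x)^k·V_f(x,U) → c_f·U^k for U ≥ max
deg f_i), exactly as in `sieveCalibration_proof`. [difficulty: provable-now] [HalberstamRichert1974,
Lichtman2025LinearSieve, BatemanHorn1962, IwaniecInventiones1978]
#9 LinearCalibration (support) — Both mechanism statements for the rough INTEGERS (system (X),
written over ℕ): (i) |2·#{n ≤ x : P⁻(n) ≥ x^{1/U}, Ω(n) odd} − Φ(x, x^{1/U})| ≤ δ·Φ for U ≥ U₀(δ),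
∀ᶠ x; (ii) |π-cell·(U e^{−γ}/2) − odd-cell| ≤ η·odd-cell for U ≥ U₀(η), ∀ᶠ x. Provable now (size L):
the tree's Alladi theorem with a rate `Literature.NumberTheory.Sieve.exists_abs_cell_sub_main_le`
gives each cell #{Ω = j} = I_j(U)·x/log x·(1 + O(1/log y)) for U bounded;
`sum_roughCellDensity_eq_mul_buchstabOmega` gives Σ_j I_j = Uω(U); the alternating sum a(U) := Σ_j
(−1)^j I_j(U) solves a′(u) = −a(u−1)/(u−1), a = −1 on [1,2], so a(u) = −ρ(u−1) → 0 (parity-split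
Buchstab; a(3) = log 2 − 1); and ω(U) → e^{−γ} is `harman2007_buchstabOmega_tendsto_holds`. Hence
odd-cell ~ Uω/2·x/log x ~ Ue^{−γ}/2·x/log x and π-cell ~ x/log x. [difficulty: provable-now]
[Alladi1982, Alladi1982Moebius, Tenenbaum2015, MontgomeryVaughan2007, Harman2007,
Lichtman2025LinearSieve]

TWO-LAYER PLAN. Foreseen glued splits (filed only when a crux moves, k ≤ 3, depth 1):
RoughParityBalance ⇐ BalanceLinear (all-linear systems: for k = 1
Alladi in progressions, provable; k ≥ 2 = sifted 2-point/k-point Chowla, open) → BalanceQuadratic (a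
member of degree 2: the first thin case,
where root equidistribution to moduli slightly beyond x exists, DFI/Tóth) → BalanceHigher →
RoughParityBalance (glue: case split on the
degree profile). OddSectorShareLinear ⇐ ShareSingleProgression (k = 1, provable) →
ShareTuplesUnderGEH (Bombieri two-sided rigidity as in
RoughSemiprimeRigidity, conditional) → unconditional residual. OddSectorShareNonlinear ⇐
ShareTopCell (the cells with one prime factor > x,
switched to the cofactor pencils f_i(ν+mt)/m: the free-large-prime regime of card
free-tail-anti-elliott) → ShareMediumCells (all prime
factors ≤ x^{1−ε}: pure root-class anatomy) → OddSectorShareNonlinear.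

KILL CRITERIA. RoughParityBalance REFUTED for one system (a theorem, or certified numerics at
growing depth, exhibiting a Walsh/parity bias of rough values
of f that does not decay as U → ∞) refutes Bateman–Horn-type randomness along f: close
`refuted:RoughParityBalance`, file the Ω-statement on
the negative side — news for every BatemanHorn route. OddSectorShareNonlinear or
OddSectorShareLinear REFUTED (an anatomy bias of polynomial /
tuple values relative to integers persisting as U → ∞): close `refuted:<Decl>` with census "anatomy,
not parity"; if the refutation is a
finite-depth artefact (share converging to the model only as U → ∞ — which the items already allow)
it is not a refutation. RoughCountBand
rests on proved tree theorems: a refutation can only be a normalisation slip (constant e^{−kγ},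
thresholds, U^k) ⇒ PIVOT (restate), never
close. Assembly refuted ⇒ bookkeeping slip ⇒ restate. BatemanHorn proved elsewhere, or
PolyMobiusTail / RoughValueLaw∧BalancedSemiprimeLayer
proved, moots the route (close `superseded`).

NOT DECOMPOSED YET. (i) Rates: the items are o(1)-in-U statements; the model rates (bias ρ′(U)/ω(U)
≍ 1/Γ(U), share error ≍ ρ(U−1), band error e^{−U}) are
recorded in NUMBERS, not asserted. (ii) The even sector and the full cell structure (single-ghost
law c_j = (1+θ(−1)^{j+1})m_j, Walsh
coefficients of mixed sectors): not needed by `closes`, deliberately not filed (LeeYangFibres'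
CellParityLaw is the GHL-side home of that
structure). (iii) Any engine for rank 3: none is claimed — candidate inputs (cofactor-pencil anatomy
on average over m; function-field
calibration q → ∞ via cycle types, Entin2016; descent self-similarity of the share under Buchstab's
identity) are layer-2 matters.
(iv) The fixed-depth signed law RL(f,u) of card rough-values-buchstab-parity (BH-strength per rung)
and any statement at u ≤ 2 — excluded by
design. (v) Uniformity in f (false at log-power heights: UniformBatemanHornBarrier) — never asked.

CHEAPEST FALSIFIER. One kit job (pure python/flint, ≤ 1 node-day): for f ∈ {X²+1, X²+X+1, 2X²+2X+1,
X³+2, (X,X+2), (X,X²+1)} to x = 10⁹ (deg 2), 10^6.5 (deg 3), 10¹⁰ (linear pairs), U ∈ [3,6] step ¼: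
normalised share c₁(Ue^{−γ}/2)^k/c_odd and sector bias 2^k c_odd/#R − 1, AGAINST (a) the model
curves (share·(Ue^{−γ}/2) = 0.939, 0.979, 0.994, 0.998 and bias −0.066, −0.022, −0.0064, −0.0018 at
U = 3.5, 4, 4.5, 5) and (b) sampled integers of matched size and depth (cancels the O(1/log y)
drift). A converged f-vs-ℤ share discrepancy > 1% at U ≤ 5, or a bias that stops decaying in U,
kills rank 3/4 resp. rank 2 for that f. RUN AT FILING (x = 10⁶ for n²+1, X = 10⁷ for ℤ): share 0.964
vs 0.961 (U = 3.5), 1.034 vs 1.032 (U = 4); bias −0.133/−0.129 (3.5), −0.059/−0.063 (4),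
−0.031/−0.031 (4.5); band/(c_f U) = 1.003, 0.997, 0.994 (U = 3, 3.5, 4) — no kill, f rides the
integer curves. Lookup that would make rank 2 `known` for a class: a sifted Chowla theorem along any
nonlinear f (none found: Teravainen2024 surveys the unsifted problem as wide open).

NUMBERS. Model (integers, depth U; tree `roughCellDensity`, Σ_j I_j = Uω(U)): Uω(U) = 1.693, 1.963,
2.246, 2.527, 2.807, 3.369 at U = 3, 3.5, 4, 4.5, 5, 6;
share I₁/Σ_{j odd} I_j = 1, 0.9555, 0.8717, 0.7865, 0.7112, 0.5936; normalised share ·(Ue^{−γ}/2) =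
0.8422, 0.9388, 0.9788, 0.9936, 0.9983,
0.9999; bias (Σ_even − Σ_odd)/Σ = −ρ(U−1)/(Uω(U)) = −0.1812, −0.0664, −0.0216, −0.0064, −0.0018,
−0.0001; e^{−γ} = 0.56146; window of the
linear sieve F(s) − f(s) = 2e^γρ(s−1)/s (0.364 at s = 3, 0.043 at s = 4) — twice the parity bias,
attained by Selberg's sets 𝒜^± (LinearSieveOptimality).
Filing numerics (x = 10⁶, f = X²+1, values to 10¹²; integers X = 10⁷), U = 3, 3.5, 4, 4.5, 5, 6: y =
10000, 2683, 1000, 465, 252, 100 (f) /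
216, 100, 57, 36, 26, 15 (ℤ); #R = 83923, 97334, 110920, 122735, 137656, 162611 (f); band/(c_fU) =
1.003, 0.997, 0.994, 0.978, 0.987, 0.972 (f),
0.995, 0.987, 0.977, 0.975, 0.939, 0.918 (ℤ); normalised share = 0.842, 0.964, 1.034, 1.080, 1.087,
1.114 (f) vs 0.842, 0.961, 1.032, 1.065,
1.117, 1.156 (ℤ); bias L/#R = −0.289, −0.133, −0.059, −0.031, −0.015, −0.006 (f) vs −0.279, −0.129,
−0.063, −0.031, −0.021, −0.010 (ℤ);
c₁ = 54091…54106 = π_{n²+1}(10⁶) − π_{n²+1}(y^{1/2}) (BH ratio c₁ log x/(x·𝔖/2) = 1.089, li-drift).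
C(X²+1) = 𝔖 = 1.37281, twin 2C₂ = 1.32032.
Items at open: 6 (3 cruxes, 2 supports, 1 assembly) + `closes`.

DEFINITION REQUESTS. None needed to typecheck: the rough set, cells and sectors are inline decidable
`Finset.filter`s over `Finset.Icc 1 x` (RoughValueTransport's
predicate verbatim), Ω is Mathlib's `ArithmeticFunction.cardFactors`, γ is
`Real.eulerMascheroniConstant`, C(f) is
`Literature.NumberTheory.Sieve.batemanHornConst`; Sketch.lean elaborates (lean check rc 0, 0 sorry).
Optional later (tenure): a light-import
named `roughValueSet f x U : Finset ℕ` under Summits/Parity/BatemanHorn/Theorems to shorten the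
items (bridge lemma `= filter …` by `rfl`).

Novelty: Searches (2026-08-16): local `lit search` index DOWN all session (searchd connection reset; noted in
NOTES.md); `lit search --source crossref` ×9
("Alladi … Moebius" → doi:10.1016/0022-314x(82)90060-9, doi:10.2307/1998952; "distribution of nu(n)
sieve of Eratosthenes" → doi:10.1093/qmath/33.2.129;
"Selberg's sieve with weights Richert" → doi:10.1112/s0025579300004563, added as Richert1969;
"almost-primes quadratic polynomials Iwaniec" →
doi:10.1007/bf01578070; "parity … sifted integers Buchstab" → Alladi–Goswami 2026
doi:10.1007/978-3-032-10837-1_8 (integers), Hildebrand/Tenenbaum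
smooth-side laws; "asymptotic sieve Bombieri" → twin almost-primes only); `lit search --source
arxiv` ×4 (0 relevant); `lit vsearch` "Liouville over
integers with all prime factors large, Buchstab, rho′" (8 books: MV2007, Harman2007, Elliott —
integer laws only); `lit galaxy search --star all/pdf` ×4
(0 relevant); `lean search Alladi` (tree: RoughOmegaCells*, RoughCellDensity,
exists_abs_cell_sub_main_le — PROVED), `lean search` for stub_sieveBand,
tendsto_log_pow_mul_staggeredProd, roughLiouvilleSaving_of_roughLatticeCount,
CellParityLaw/ModelHyperbolicity; all 25 BatemanHorn route files and
the 32 GHL route headers/items; BH Ideas (24 open + 115 closed); Cruxes/ dossiers (PolyMobiusTail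
STRATEGY-CENSUS; SystemZeroRepulsion, RoughValueLaw,
BalancedSemiprimeLayer dead lines); `ledger negatives --problem Parity` (3, all GHL).
Nearest prior art found: Alladi1982 + Alladi1982Moebius (integer case of bo  [refs: 10.1016/0022-314x(82, 10.2307/1998952, 10.1093/qmath/33.2.129, 10.1112/s0025579300004563, 10.1007/bf01578070, 10.1007/978-3-032-10837-1_8, doi:10.1016/0022-314x, doi:10.2307/1998952, doi:10.1093/qmath/33.2.129, doi:10.1112/s0025579300004563, doi:10.1007/bf01578070, doi:10.1007/978-3-032-10837-1_8, Richert1969, Harman2007, Alladi1982, BombieriAsymptoticSieve1976, Ford2004]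

Barriers (technique_class: asymptotic-sieve, rough-values, parity-functional): - technique_class: asymptotic-sieve, rough-values, parity-functional
- Literature.Barriers.Parity.SelbergParityBarrier: NOT evaded — LOCALISED exactly: the twists
1±λ(fᵢ(n)) keep all root-class data asymptotically, fix the OddSectorShare* ratios identically
(RoughCountBand, a theorem about the untwisted count, is not at stake) and move RoughParityBalance
to its extremes; rank 2 is the barrier's content in its weakest form (sifted, constant-free, o(1) as
U → ∞, integer case = Alladi's theorem); the bet is that this is the cheapest parity statement any
BatemanHorn route has isolated, and that its complement is attackable without parity input.
- Literature.Barriers.Parity.LinearSieveOptimality: consistent and used as the frame — Selberg's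
sets 𝒜^± (Ω odd / even) attain F and f; rank 2 says the rough values of f split evenly between them
at infinite depth; no asymptotic inside the window at finite s is ever asked (the band is used only
as U → ∞, where F − f → 0).
- Literature.Barriers.Parity.WeightedSieveLimit: applies to any weighted-sieve attack on ranks 3–4
(Λ_R ≤ R: level-x^{1−ε}, degree-g data give P_{g+1} values, never P₁ shares) — named as the reason
the share cruxes are cruxes; not evaded.
- Literature.Barriers.Parity.FordFixedLevelBarrier: APPLIES to OddSectorShareNonlinear (value-level
1/deg < 1: Λ₂-type anatomy not determined) and, at level 1/2, to OddSectorShareLinear; named, not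
evaded; for all-linear systems level 1 is GEH and Bombieri rigidity is the foreseen condi

History (route lifecycle, newest last):
- 2026-08-24T10:53:17Z · DORMANT — reconciler: no traction for 6.7 d (last activity item-evidence-added at 2026-08-17T17:02:24Z); parked, not closed — `ledger route dormant route-Parity-RoughPari (operator:999:40457)

sub-problem: BatemanHorn · status: dormant · opened planner-plan-lens-Parity-recomb-v2-0 2026-08-16T15:46:50Z · rev 4 · ledger route-Parity-RoughParitySectors
GENERATED by the gate from the ledger (D-0016/17). Provers cite these decls: `theorem foo : Summit.Parity.BatemanHorn.Theses.RoughParitySectors.<Decl> := …` in Summits/Parity/BatemanHorn/Theorems/<Name>.lean.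
-/

namespace Summit.Parity.BatemanHorn.Theses.RoughParitySectors

open scoped BigOperators Topology Manifold Classical MeasureTheory ProbabilityTheory Matrix InnerProductSpace ComplexConjugate ContinuousMap
open Filter Set Function TopologicalSpace MeasureTheory

attribute [summit_statement] _root_.BatemanHorn

/-- item stmt-Parity-15627 · crux · rank 2 · open · by planner
why it might fail: It is the parity bit: Selberg's twists 1±λ(fᵢ(n)) keep all root-class data, satisfy the other items and move 2^k·c_odd/#R to 0 or 2; given the share cruxes and the band it is EQUIVALENT to Bateman–Horn; even f=(X) needs the prime number theorem (Alladi).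
sources: Alladi1982Moebius, Selberg1952Limitations, BombieriAsymptoticSieve1976, Tenenbaum2015, Teravainen2024, SawinShusterman2022
[crux] For every Bateman–Horn system f of k polynomials and every δ > 0 there is U₀ such that for
every U ≥ U₀, for all large x, |2^k·c_odd(x,U) − #R_f(x,U)| ≤ δ·#R_f(x,U): the all-odd parity sector
of the jointly rough values has density 2^{−k}, asymptotically in the depth. k = 1: Σ_{n∈R} λ(f(n))
= o_U(#R) ("Alladi along f"); model value of the bias at finite U is (ρ′(U)/ω(U))-sized (−0.18 at U
= 3, −0.02 at U = 4, −0.002 at U = 5), which is why no fixed-depth form is asserted (card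
rough-values-buchstab-parity, signed half, tail only). [difficulty: open-problem] -/
@[route_item "route-Parity-RoughParitySectors", crux]
def RoughParityBalance : Prop :=
  ∀ (k : ℕ) (f : Fin k → Polynomial ℤ), Literature.NumberTheory.Sieve.IsBatemanHornSystem f → ∀ δ : ℝ, 0 < δ → ∃ U₀ : ℝ, ∀ U : ℝ, U₀ ≤ U → ∀ᶠ x : ℕ in Filter.atTop, |(2 : ℝ) ^ k * (((((Finset.Icc 1 x).filter (fun n : ℕ => ∀ i, 0 < (f i).eval (n : ℤ) ∧ ∀ p ∈ Finset.range ⌈(x : ℝ) ^ (((f i).natDegree : ℝ) / U)⌉₊, p.Prime → ¬ ((p : ℤ) ∣ (f i).eval (n : ℤ)))).filter (fun n : ℕ => ∀ i, Odd (ArithmeticFunction.cardFactors (((f i).eval (n : ℤ)).toNat)))).card : ℕ) : ℝ) - ((((Finset.Icc 1 x).filter (fun n : ℕ => ∀ i, 0 < (f i).eval (n : ℤ) ∧ ∀ p ∈ Finset.range ⌈(x : ℝ) ^ (((f i).natDegree : ℝ) / U)⌉₊, p.Prime → ¬ ((p : ℤ) ∣ (f i).eval (n : ℤ)))).card : ℕ)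 : ℝ)| ≤ δ * ((((Finset.Icc 1 x).filter (fun n : ℕ => ∀ i, 0 < (f i).eval (n : ℤ) ∧ ∀ p ∈ Finset.range ⌈(x : ℝ) ^ (((f i).natDegree : ℝ) / U)⌉₊, p.Prime → ¬ ((p : ℤ) ∣ (f i).eval (n : ℤ)))).card : ℕ) : ℝ)

/-- item stmt-Parity-15628 · crux · rank 3 · open · by planner
why it might fail: Dark anatomy past every Type-I level: prime-vs-E₃,E₅,… frequencies among rough values of a degree≥2 member are not fixed by root-class data of level x^{1−ε} (value-level 1/deg: Ford-type indeterminacy); an algebraic bias of the norm values N(n−α) toward split types breaks it.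
sources: Alladi1982, Ford2004, BombieriAsymptoticSieve1976, IwaniecInventiones1978, Richert1969, Entin2016
[crux] For every Bateman–Horn system f with SOME member of degree ≥ 2 and every η > 0 there is U₀
such that for every U ≥ U₀, for all large x, |c₁(x,U)·(U·e^{−γ}/2)^k − c_odd(x,U)| ≤ η·c_odd(x,U):
among jointly rough values with all Ω(f_i(n)) odd, the proportion with every f_i(n) prime is the
integer-model share (2/(U(ω(U)−ρ′(U))))^k → (2e^γ/U)^k. Invariant under every twist a_n ↦
a_n∏(1+θ_iλ(f_i(n))) (all all-odd cells scale by ∏(1−θ_i)); carries no information on the prime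
count beyond the sieve factor 2^k; the dark-anatomy half of Bombieri's dichotomy for thin value
sets. [difficulty: open-problem] -/
@[route_item "route-Parity-RoughParitySectors", crux]
def OddSectorShareNonlinear : Prop :=
  ∀ (k : ℕ) (f : Fin k → Polynomial ℤ), Literature.NumberTheory.Sieve.IsBatemanHornSystem f → (∃ i, 2 ≤ (f i).natDegree) → ∀ η : ℝ, 0 < η → ∃ U₀ : ℝ, ∀ U : ℝ, U₀ ≤ U → ∀ᶠ x : ℕ in Filter.atTop, |(((((Finset.Icc 1 x).filter (fun n : ℕ => ∀ i, 0 < (f i).eval (n : ℤ) ∧ ∀ p ∈ Finset.range ⌈(x : ℝ) ^ (((f i).natDegree : ℝ) / U)⌉₊, p.Prime → ¬ ((p : ℤ) ∣ (f i).eval (n : ℤ)))).filter (fun n : ℕ => ∀ i, ArithmeticFunction.cardFactors (((f i).eval (n : ℤ)).toNat) = 1)).card : ℕ) : ℝ) * (U * Real.exp (-Real.eulerMascheroniConstant) / 2) ^ k - (((((Finset.Icc 1 x).filter (fun n : ℕ => ∀ i, 0 < (f i).eval (n : ℤ) ∧ ∀ p ∈ Finset.range ⌈(x : ℝ) ^ (((f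 i).natDegree : ℝ) / U)⌉₊, p.Prime → ¬ ((p : ℤ) ∣ (f i).eval (n : ℤ)))).filter (fun n : ℕ => ∀ i, Odd (ArithmeticFunction.cardFactors (((f i).eval (n : ℤ)).toNat)))).card : ℕ) : ℝ)| ≤ η * (((((Finset.Icc 1 x).filter (fun n : ℕ => ∀ i, 0 < (f i).eval (n : ℤ) ∧ ∀ p ∈ Finset.range ⌈(x : ℝ) ^ (((f i).natDegree : ℝ) / U)⌉₊, p.Prime → ¬ ((p : ℤ) ∣ (f i).eval (n : ℤ)))).filter (fun n : ℕ => ∀ i, Odd (ArithmeticFunction.cardFactors (((f i).eval (n : ℤ)).toNat)))).card : ℕ) : ℝ)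

/-- item stmt-Parity-15629 · crux · rank 4 · open · by planner
why it might fail: For k≥2 it is almost-prime k-tuple anatomy (e.g. among jointly rough n, n+2 with odd Ω's, the share with both prime): level-1/2 bilinear data do not fix it (Ford-type indeterminacy at fixed level), plausibly rigid only under GEH; a tuple-specific bias breaks it.
sources: Alladi1982, BombieriAsymptoticSieve1976, Ford2004, GreenTao2010, HalberstamRichert1974, Lichtman2025LinearSieve
[crux] The same share statement for ALL-LINEAR Bateman–Horn systems (every deg f_i = 1: Dickson /
Hardy–Littlewood tuples, incl. the twin system (X, X+2)): |c₁·(U e^{−γ}/2)^k − c_odd| ≤ η·c_odd for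
U ≥ U₀(η), eventually in x. k = 1 (one progression) is Alladi's cell theorem in progressions
(provable; cf. support LinearCalibration); k ≥ 2 is almost-prime-tuple anatomy in the
Bombieri-rigidity world (each member has bilinear structure and level 1/2; level 1 = GEH), the
interface with GHL routes LeeYangFibres (CellParityLaw ⇒ this item) and RoughSemiprimeRigidity.
[difficulty: XL] -/
@[route_item "route-Parity-RoughParitySectors", crux]
def OddSectorShareLinear : Prop :=
  ∀ (k : ℕ) (f : Fin k → Polynomial ℤ), Literature.NumberTheory.Sieve.IsBatemanHornSystem f → (∀ i, (f i).natDegree ≤ 1) → ∀ η : ℝ, 0 < η → ∃ U₀ : ℝ, ∀ U : ℝ, U₀ ≤ U → ∀ᶠ x : ℕ in Filter.atTop, |(((((Finset.Icc 1 x).filter (fun n : ℕ => ∀ i, 0 < (f i).eval (n : ℤ) ∧ ∀ p ∈ Finset.range ⌈(x : ℝ) ^ (((f i).natDegree : ℝ) / U)⌉₊, p.Prime → ¬ ((p : ℤ) ∣ (f i).eval (n : ℤ)))).filter (fun n : ℕ => ∀ i, ArithmeticFunction.cardFactors (((f i).eval (n : ℤ)).toNat) = 1)).card : ℕ) : ℝ)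 * (U * Real.exp (-Real.eulerMascheroniConstant) / 2) ^ k - (((((Finset.Icc 1 x).filter (fun n : ℕ => ∀ i, 0 < (f i).eval (n : ℤ) ∧ ∀ p ∈ Finset.range ⌈(x : ℝ) ^ (((f i).natDegree : ℝ) / U)⌉₊, p.Prime → ¬ ((p : ℤ) ∣ (f i).eval (n : ℤ)))).filter (fun n : ℕ => ∀ i, Odd (ArithmeticFunction.cardFactors (((f i).eval (n : ℤ)).toNat)))).card : ℕ) : ℝ)| ≤ η * (((((Finset.Icc 1 x).filter (fun n : ℕ => ∀ i, 0 < (f i).eval (n : ℤ) ∧ ∀ p ∈ Finset.range ⌈(x : ℝ) ^ (((f i).natDegree : ℝ) / U)⌉₊, p.Prime → ¬ ((p : ℤ) ∣ (f i).eval (n : ℤ)))).filter (fun n : ℕ => ∀ i, Odd (ArithmeticFunction.cardFactors (((f i).eval (n : ℤ)).toNat)))).card : ℕ) : ℝ)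

/-- item stmt-Parity-15630 · support · rank 9 · closed · proved by Summit.Parity.BatemanHorn.Theorems.RoughCountBand.roughCountBand_proof @ 9c72f4abcbeb (prover) · by planner
sources: HalberstamRichert1974, Lichtman2025LinearSieve, BatemanHorn1962, IwaniecInventiones1978
[support] For every Bateman–Horn system f and ε > 0 there is U₀ such that for every U ≥ U₀,
eventually in x, |#R_f(x,U)·(log x)^k/x − c_f·U^k| ≤ ε·c_f·U^k with c_f = (C(f)/∏deg f_i)·e^{−kγ},
C(f) = batemanHornConst f. Provable now (size M): combine the banked two-sided fundamental-lemma
band `Summit.Parity.BatemanHorn.Cruxes.RoughValueLaw.IncrementAnchoring.stub_sieveBand`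
(Theorems/RoughValueTransportRoughValueLawSieveBand.lean: |Φ_f(x,U) − xV_f(x,U)| ≤ ε′xV_f(x,U) for U
≥ U₁(ε′), ∀ᶠ x — same predicate) with staggered Mertens
`SieveCalibration.tendsto_log_pow_mul_staggeredProd`
(Theorems/RoughValueTransportSieveCalibrationMertens.lean: (log x)^k·V_f(x,U) → c_f·U^k for U ≥ max
deg f_i), exactly as in `sieveCalibration_proof`. [difficulty: provable-now] -/
@[route_item "route-Parity-RoughParitySectors"]
def RoughCountBand : Prop :=
  ∀ (k : ℕ) (f : Fin k → Polynomial ℤ), Literature.NumberTheory.Sieve.IsBatemanHornSystem f → ∀ ε : ℝ, 0 < ε → ∃ U₀ : ℝ, ∀ U : ℝ, U₀ ≤ U → ∀ᶠ x : ℕ in Filter.atTop, |((((Finset.Icc 1 x).filter (fun n : ℕ => ∀ i, 0 < (f i).eval (n : ℤ) ∧ ∀ p ∈ Finset.range ⌈(x : ℝ) ^ (((f i).natDegree : ℝ) / U)⌉₊, p.Prime → ¬ ((p : ℤ) ∣ (f i).eval (n : ℤ)))).card : ℕ) : ℝ) * Real.log x ^ k / (x : ℝ) - Literature.NumberTheory.Sieve.batemanHornConst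 f / (∏ i, ((f i).natDegree : ℝ)) * Real.exp (-((k : ℝ) * Real.eulerMascheroniConstant)) * U ^ k| ≤ ε * (Literature.NumberTheory.Sieve.batemanHornConst f / (∏ i, ((f i).natDegree : ℝ)) * Real.exp (-((k : ℝ) * Real.eulerMascheroniConstant)) * U ^ k)

/-- item stmt-Parity-15631 · support · rank 9 · closed · proved by Summit.Parity.BatemanHorn.Theorems.LinearCalibration.linearCalibration_proof @ a70461d98f72 (prover) · by planner
sources: Alladi1982, Alladi1982Moebius, Tenenbaum2015, MontgomeryVaughan2007, Harman2007, Lichtman2025LinearSieve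
[support] Both mechanism statements for the rough INTEGERS (system (X), written over ℕ): (i) |2·#{n
≤ x : P⁻(n) ≥ x^{1/U}, Ω(n) odd} − Φ(x, x^{1/U})| ≤ δ·Φ for U ≥ U₀(δ), ∀ᶠ x; (ii) |π-cell·(U
e^{−γ}/2) − odd-cell| ≤ η·odd-cell for U ≥ U₀(η), ∀ᶠ x. Provable now (size L): the tree's Alladi
theorem with a rate `Literature.NumberTheory.Sieve.exists_abs_cell_sub_main_le` gives each cell #{Ω
= j} = I_j(U)·x/log x·(1 + O(1/log y)) for U bounded; `sum_roughCellDensity_eq_mul_buchstabOmega`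
gives Σ_j I_j = Uω(U); the alternating sum a(U) := Σ_j (−1)^j I_j(U) solves a′(u) = −a(u−1)/(u−1), a
= −1 on [1,2], so a(u) = −ρ(u−1) → 0 (parity-split Buchstab; a(3) = log 2 − 1); and ω(U) → e^{−γ} is
`harman2007_buchstabOmega_tendsto_holds`. Hence odd-cell ~ Uω/2·x/log x ~ Ue^{−γ}/2·x/log x and
π-cell ~ x/log x. [difficulty: provable-now] -/
@[route_item "route-Parity-RoughParitySectors"]
def LinearCalibration : Prop :=
  (∀ δ : ℝ, 0 < δ → ∃ U₀ : ℝ, ∀ U : ℝ, U₀ ≤ U → ∀ᶠ x : ℕ in Filter.atTop, |2 * (((((Finset.Icc 1 x).filter (fun n : ℕ => ∀ p ∈ Finset.range ⌈(x : ℝ) ^ (1 / U)⌉₊, p.Prime → ¬ (p ∣ n))).filter (fun n : ℕ => Odd (ArithmeticFunction.cardFactors n))).card : ℕ) : ℝ) - ((((Finset.Icc 1 x).filter (fun n : ℕ => ∀ p ∈ Finset.range ⌈(x : ℝ) ^ (1 / U)⌉₊, p.Prime → ¬ (p ∣ n))).card : ℕ) : ℝ)| ≤ δ * ((((Finset.Icc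 1 x).filter (fun n : ℕ => ∀ p ∈ Finset.range ⌈(x : ℝ) ^ (1 / U)⌉₊, p.Prime → ¬ (p ∣ n))).card : ℕ) : ℝ)) ∧ (∀ η : ℝ, 0 < η → ∃ U₀ : ℝ, ∀ U : ℝ, U₀ ≤ U → ∀ᶠ x : ℕ in Filter.atTop, |(((((Finset.Icc 1 x).filter (fun n : ℕ => ∀ p ∈ Finset.range ⌈(x : ℝ) ^ (1 / U)⌉₊, p.Prime → ¬ (p ∣ n))).filter (fun n : ℕ => ArithmeticFunction.cardFactors n = 1)).card : ℕ) : ℝ) * (U * Real.exp (-Real.eulerMascheroniConstant) / 2) - (((((Finset.Icc 1 x).filter (fun n : ℕ => ∀ p ∈ Finset.range ⌈(x : ℝ) ^ (1 / U)⌉₊, p.Prime → ¬ (p ∣ n))).filter (fun n : ℕ => Odd (ArithmeticFunction.cardFactors n))).card : ℕ) : ℝ)| ≤ η * (((((Finset.Icc 1 x).filter (fun n : ℕ => ∀ p ∈ Finset.range ⌈(x : ℝ) ^ (1 / U)⌉₊, p.Prime → ¬ (p ∣ n))).filter (fun n : ℕ => Odd (ArithmeticFunction.cardFactors n))).card : ℕ)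 : ℝ))

/-- item stmt-Parity-15632 · assembly · rank 1 · open · by planner
sources: BatemanHorn1962, Alladi1982, HalberstamRichert1974
[assembly] RoughParityBalance → OddSectorShareNonlinear → OddSectorShareLinear → RoughCountBand →
BatemanHorn (the squeeze above; provable-now bookkeeping, size L). -/
@[route_item "route-Parity-RoughParitySectors"]
def Assembly : Prop :=
  RoughParityBalance → OddSectorShareNonlinear → OddSectorShareLinear → RoughCountBand → _root_.BatemanHorn

/-! D-0027 §2.1 — DECIDING THEOREM (planner-authored via `route open/edit --closes-file`; by planner-rbadge-Parity-RoughParitySectors-b01bab53-g2-0 2026-08-16T17:19:08Z):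
its hypotheses are this route's items and its conclusion the sub-problem Statement (glue_lint), and it elaborates with this file. -/

@[closes "route-Parity-RoughParitySectors"] theorem closes (hP : RoughParityBalance) (hN : OddSectorShareNonlinear)
    (hL : OddSectorShareLinear) : _root_.BatemanHorn := by
  intro k f hf
  obtain ⟨hC, hC0⟩ := Literature.NumberTheory.Sieve.IsBatemanHornSystem.hasBatemanHornConst_holds hf
  refine ⟨_, hC, ?_⟩
  obtain ⟨m, hm⟩ : ∃ m : ℝ, m = Literature.NumberTheory.Sieve.batemanHornConst f /
      ∏ i, ((f i).natDegree : ℝ) := ⟨_, rfl⟩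
  have hm0 : 0 < m := by
    rw [hm]; exact div_pos hC0 (Finset.prod_pos fun i _ => by exact_mod_cast hf.natDegree_pos i)
  rw [← hm, Fintype.card_fin]
  -- growth thresholds (n ^ deg fᵢ ≤ 2 fᵢ(n) for n ≥ M i) and the degree bound
  choose M hM using fun i =>
    Theorems.BalancedSemiprimeLayer.Negative.exists_pow_le_two_mul_eval (hf.leadingCoeff_pos i)
  have hdS : ∀ i, ((f i).natDegree : ℝ) ≤ (Finset.univ.sup fun i => (f i).natDegree : ℕ) := fun i => by
    exact_mod_cast Finset.le_sup (f := fun i => (f i).natDegree) (Finset.mem_univ i)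
  -- the share crux that applies (by degree profile)
  have hS := fun η (hη : (0 : ℝ) < η) =>
    if h : ∃ i, 2 ≤ (f i).natDegree then hN k f hf h η hη
    else hL k f hf (fun i => by by_contra h'; exact h ⟨i, by omega⟩) η hη
  -- the prime cell inside `polyPrimeCount`, and the complement: n = 0, n < M i, or n ≤ 2 fᵢ(n) < 2⌈x^{1/4}⌉₊
  have hE : ∀ (U : ℝ) (x : ℕ), 4 * ((Finset.univ.sup fun i => (f i).natDegree : ℕ) : ℝ) + 1 ≤ U →
      2 ≤ x → ∀ s : Finset ℕ, s = ((Finset.Icc 1 x).filter (fun n : ℕ => ∀ i, 0 < (f i).eval (n : ℤ) ∧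
        ∀ p ∈ Finset.range ⌈(x : ℝ) ^ (((f i).natDegree : ℝ) / U)⌉₊, p.Prime →
          ¬ ((p : ℤ) ∣ (f i).eval (n : ℤ)))).filter
        (fun n : ℕ => ∀ i, ArithmeticFunction.cardFactors (((f i).eval (n : ℤ)).toNat) = 1) →
      s.card ≤ Literature.NumberTheory.Sieve.polyPrimeCount f x ∧
        Literature.NumberTheory.Sieve.polyPrimeCount f x ≤ (s ∪ (Finset.range (1 + Finset.univ.sup M) ∪
          Finset.range (2 * ⌈(x : ℝ) ^ (1 / 4 : ℝ)⌉₊))).card := by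
    rintro U x hU hx s rfl
    have hP' : Literature.NumberTheory.Sieve.polyPrimeCount f x = ((Finset.range (x + 1)).filter
        fun n : ℕ => ∀ i, 0 < (f i).eval (n : ℤ) ∧ ((f i).eval (n : ℤ)).toNat.Prime).card := by
      unfold Literature.NumberTheory.Sieve.polyPrimeCount; congr
    rw [hP']
    have hx1 : (1 : ℝ) ≤ x := by exact_mod_cast (by omega : 1 ≤ x)
    have hU0 : 0 < U := by
      linarith [Nat.cast_nonneg (α := ℝ) (Finset.univ.sup fun i => (f i).natDegree)]
    constructor
    · exact Finset.card_le_card fun n hn => by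
        rw [Finset.mem_filter, Finset.mem_filter, Finset.mem_Icc] at hn
        exact Finset.mem_filter.2 ⟨Finset.mem_range.2 (by omega), fun i => ⟨(hn.1.2 i).1,
          ArithmeticFunction.cardFactors_eq_one_iff_prime.1 (hn.2 i)⟩⟩
    · refine Finset.card_le_card fun n hn => ?_
      rw [Finset.mem_filter, Finset.mem_range] at hn
      obtain ⟨hnx, hn⟩ := hn
      by_contra hc
      rw [Finset.mem_union, Finset.mem_union, Finset.mem_range, Finset.mem_range, not_or, not_or,
        not_lt, not_lt] at hc
      obtain ⟨hc, hKn, hZn⟩ := hc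
      refine hc (Finset.mem_filter.2 ⟨Finset.mem_filter.2 ⟨Finset.mem_Icc.2 ⟨by omega, by omega⟩,
        fun i => ⟨(hn i).1, fun p hp hpp hpd => ?_⟩⟩,
        fun i => ArithmeticFunction.cardFactors_eq_one_iff_prime.2 (hn i).2⟩)
      obtain ⟨h0, hq⟩ := hn i
      have hpq : p = ((f i).eval (n : ℤ)).toNat := (Nat.prime_dvd_prime_iff_eq hpp hq).1
        (by rwa [← Int.natCast_dvd_natCast, Int.toNat_of_nonneg h0.le])
      have hpe : (p : ℤ) = (f i).eval (n : ℤ) := by rw [hpq, Int.toNat_of_nonneg h0.le]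
      have h1 := hM i n ((Finset.le_sup (f := M) (Finset.mem_univ i)).trans (by omega))
      have h2 : (n : ℤ) ≤ (n : ℤ) ^ (f i).natDegree := by
        exact_mod_cast Nat.le_self_pow (hf.natDegree_pos i).ne' n
      have h3 : p < ⌈(x : ℝ) ^ (1 / 4 : ℝ)⌉₊ := (Finset.mem_range.1 hp).trans_le (Nat.ceil_mono
        (Real.rpow_le_rpow_of_exponent_le hx1 (by rw [div_le_iff₀ hU0]; linarith [hdS i])))
      omega
  -- the iterated limit `x → ∞` then `U → ∞`, as one eventual bound for each τ ≤ 1/8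
  have key : ∀ τ : ℝ, 0 < τ → τ ≤ 1 / 8 → ∀ᶠ x : ℕ in atTop,
      |(Literature.NumberTheory.Sieve.polyPrimeCount f x : ℝ) * Real.log x ^ k / x - m| ≤
        τ * (8 * m + 1) := by
    intro τ hτ hτ1
    obtain ⟨U₁, h₁⟩ := hP k f hf τ hτ
    obtain ⟨U₂, h₂⟩ := hS τ hτ
    obtain ⟨U₃, h₃⟩ := Cruxes.RoughValueLaw.IncrementAnchoring.stub_sieveBand k f hf τ hτ
    obtain ⟨U, hU₁, hU₂, hU₃, hU⟩ : ∃ U : ℝ, U₁ ≤ U ∧ U₂ ≤ U ∧ U₃ ≤ U ∧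
        4 * ((Finset.univ.sup fun i => (f i).natDegree : ℕ) : ℝ) + 1 ≤ U :=
      ⟨max (max U₁ U₂) (max U₃ (4 * ((Finset.univ.sup fun i => (f i).natDegree : ℕ) : ℝ) + 1)),
        by simp, by simp, by simp, by simp⟩
    have hU0 : 0 < U := by
      linarith [Nat.cast_nonneg (α := ℝ) (Finset.univ.sup fun i => (f i).natDegree)]
    have hV := Theorems.SieveCalibration.tendsto_log_pow_mul_staggeredProd k f hf U
      (fun i => by linarith [hdS i])
    obtain ⟨B, hB⟩ : ∃ B : ℝ, B = m * Real.exp (-((k : ℝ) * Real.eulerMascheroniConstant)) * U ^ k :=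
      ⟨_, rfl⟩
    rw [← hm, ← hB] at hV
    have hB0 : 0 < B := by rw [hB]; positivity
    have hG0 : (0 : ℝ) < 2 ^ k * (U * Real.exp (-Real.eulerMascheroniConstant) / 2) ^ k := by positivity
    have hid : (2 : ℝ) ^ k * (U * Real.exp (-Real.eulerMascheroniConstant) / 2) ^ k =
        Real.exp (-((k : ℝ) * Real.eulerMascheroniConstant)) * U ^ k := by
      rw [neg_mul_eq_mul_neg, Real.exp_nat_mul, ← mul_pow, ← mul_pow]; congr 1; ring
    -- one link of the relative-error chain, and the final cancellation
    have step : ∀ a b s Q c : ℝ, |a - b| ≤ τ * b → 0 ≤ s → 0 ≤ Q → 0 ≤ c → c ≤ 1 →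
        (1 - c) * Q ≤ s * b → s * b ≤ (1 + c) * Q →
        (1 - (c + 2 * τ)) * Q ≤ s * a ∧ s * a ≤ (1 + (c + 2 * τ)) * Q := by
      intro a b s Q c hab hs hQ hc0 hc1 hl hu
      rw [abs_le] at hab
      have h1 : s * ((1 - τ) * b) ≤ s * a := mul_le_mul_of_nonneg_left (by linarith) hs
      have h2 : s * a ≤ s * ((1 + τ) * b) := mul_le_mul_of_nonneg_left (by linarith) hs
      have h3 : (1 - τ) * ((1 - c) * Q) ≤ (1 - τ) * (s * b) := mul_le_mul_of_nonneg_left hl (by linarith)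
      have h4 : (1 + τ) * (s * b) ≤ (1 + τ) * ((1 + c) * Q) := mul_le_mul_of_nonneg_left hu (by linarith)
      have h5 : τ * Q * c ≤ τ * Q := mul_le_of_le_one_right (by positivity) hc1
      have h6 : 0 ≤ τ * Q * c := by positivity
      constructor <;> linarith
    have cancel : ∀ L P C A X c : ℝ, 0 < P * A → (1 - c) * (X * (P * A)) ≤ L * P * (C * A) →
        L * P * (C * A) ≤ (1 + c) * (X * (P * A)) → (1 - c) * X ≤ C * L ∧ C * L ≤ (1 + c) * X := by
      intro L P C A X c h0 hl hu
      exact ⟨le_of_mul_le_mul_right (by linarith) h0, le_of_mul_le_mul_right (by linarith) h0⟩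
    have habs := Cruxes.RoughValueLaw.IncrementAnchoring.SieveBand.eventually_absorb k
      (Finset.univ.sup M + 3) (half_pos hτ)
    filter_upwards [h₁ U hU₁, h₂ U hU₂, h₃ U hU₃, Metric.tendsto_nhds.1 hV _ (mul_pos hτ hB0), habs,
      eventually_ge_atTop 2] with x ha hb hc hd habsx hx2
    have hx1 : (1 : ℝ) ≤ x := by exact_mod_cast (by omega : 1 ≤ x)
    have hX : (0 : ℝ) < x := by linarith
    have hL0 : 0 < Real.log x ^ k := pow_pos (Real.log_pos (by exact_mod_cast hx2)) k
    rw [Real.dist_eq] at hd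
    -- the chain x·B → x·(log x)^k·V → (log x)^k·#R → (log x)^k·2^k·c_odd → (log x)^k·2^k·(c₁·A)
    obtain ⟨l1, u1⟩ := step _ _ (x : ℝ) ((x : ℝ) * B) 0 hd.le hX.le (by positivity) le_rfl (by norm_num)
      (by rw [sub_zero, one_mul]) (by rw [add_zero, one_mul])
    obtain ⟨l2, u2⟩ := step _ _ _ _ _ hc hL0.le (by positivity) (by linarith) (by linarith)
      (l1.trans_eq (mul_left_comm _ _ _)) ((mul_left_comm _ _ _).trans_le u1)
    obtain ⟨l3, u3⟩ := step _ _ _ _ _ ha hL0.le (by positivity) (by linarith) (by linarith) l2 u2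
    obtain ⟨l4, u4⟩ := step _ _ _ _ _ hb (by positivity) (by positivity) (by linarith) (by linarith)
      (l3.trans_eq (mul_assoc _ _ _).symm) ((mul_assoc _ _ _).trans_le u3)
    have hQ : (x : ℝ) * B = x * m * (2 ^ k * (U * Real.exp (-Real.eulerMascheroniConstant) / 2) ^ k) := by
      rw [hB, hid]; ring
    rw [hQ] at l4 u4
    obtain ⟨f1, f2⟩ := cancel _ _ _ _ _ _ hG0 l4 u4
    -- the prime cell versus `polyPrimeCount`
    obtain ⟨hE1, hE2⟩ := hE U x hU hx2 _ rfl
    replace hE2 := (hE2.trans (Finset.card_union_le _ _)).trans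
      (Nat.add_le_add_left (Finset.card_union_le _ _) _)
    rw [Finset.card_range, Finset.card_range] at hE2
    have hE1' := mul_le_mul_of_nonneg_right (Nat.cast_le (α := ℝ) |>.2 hE1) hL0.le
    have hE2' := mul_le_mul_of_nonneg_right (Nat.cast_le (α := ℝ) |>.2 hE2) hL0.le
    have hr1 : (1 : ℝ) ≤ (x : ℝ) ^ (1 / 4 : ℝ) := Real.one_le_rpow hx1 (by norm_num)
    have hr2 : (x : ℝ) ^ (1 / 4 : ℝ) * Real.log x ^ k ≤ ((x : ℝ) ^ (1 / 4 : ℝ)) ^ 2 * Real.log x ^ k :=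
      mul_le_mul_of_nonneg_right (by rw [sq]; exact le_mul_of_one_le_left (by positivity) hr1) hL0.le
    have hZ : (⌈(x : ℝ) ^ (1 / 4 : ℝ)⌉₊ : ℝ) * Real.log x ^ k ≤ ((x : ℝ) ^ (1 / 4 : ℝ) + 1) * Real.log x ^ k :=
      mul_le_mul_of_nonneg_right (Nat.ceil_lt_add_one (by positivity)).le hL0.le
    have hSL : (0 : ℝ) ≤ (Finset.univ.sup M + 3 : ℕ) * Real.log x ^ k := by positivity
    simp only [Nat.cast_add, Nat.cast_mul, Nat.cast_one, Nat.cast_ofNat] at hE2' habsx hSL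
    have hτx := mul_pos hτ hX
    rw [abs_sub_le_iff, sub_le_iff_le_add, div_le_iff₀ hX, sub_le_comm, le_div_iff₀ hX]
    constructor <;> linarith
  -- `key` ⇒ `P_f(x) ~ m · x / (log x)^k`
  rw [Asymptotics.IsEquivalent, Asymptotics.isLittleO_iff]
  intro c hc
  have h8 : (0 : ℝ) < 8 * m + 1 := by positivity
  filter_upwards [key (min (1 / 8) (c * m / (8 * m + 1))) (lt_min (by norm_num) (by positivity))
    (min_le_left _ _), eventually_gt_atTop 1] with x hx hx1
  have hX : (0 : ℝ) < x := by exact_mod_cast zero_lt_one.trans hx1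
  have hL : 0 < Real.log x ^ k := pow_pos (Real.log_pos (by exact_mod_cast hx1)) k
  have hX0 := hX.ne'
  have hL1 := hL.ne'
  have hkey : |(Literature.NumberTheory.Sieve.polyPrimeCount f x : ℝ) * Real.log x ^ k / x - m| ≤ c * m :=
    hx.trans ((mul_le_mul_of_nonneg_right (min_le_right _ _) h8.le).trans_eq
      (div_mul_cancel₀ _ h8.ne'))
  simp only [Pi.sub_apply, Real.norm_eq_abs]
  rw [abs_of_pos (by positivity : (0 : ℝ) < m * x / Real.log x ^ k)]
  have e1 : (Literature.NumberTheory.Sieve.polyPrimeCount f x : ℝ) - m * x / Real.log x ^ k =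
      x / Real.log x ^ k *
        ((Literature.NumberTheory.Sieve.polyPrimeCount f x : ℝ) * Real.log x ^ k / x - m) := by
    field_simp
  rw [e1, abs_mul, abs_of_pos (by positivity : (0 : ℝ) < x / Real.log x ^ k)]
  calc (x : ℝ) / Real.log x ^ k * _ ≤ x / Real.log x ^ k * (c * m) :=
        mul_le_mul_of_nonneg_left hkey (by positivity)
    _ = c * (m * x / Real.log x ^ k) := by ring

end Summit.Parity.BatemanHorn.Theses.RoughParitySectors
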